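import Literature.MathematicalPhysics.QuantumFieldTheory.Balaban1983to89.B9Eq3115KnitCubeLetterY
import Literature.MathematicalPhysics.QuantumFieldTheory.Balaban1983to89.B9Eq3115KnitLetterYLaws
import Literature.MathematicalPhysics.QuantumFieldTheory.Balaban1983to89.B9Eq360PadDeltaCubeY
import Literature.MathematicalPhysics.QuantumFieldTheory.Balaban1983to89.B9Eq357CubeLetters
import Literature.MathematicalPhysics.QuantumFieldTheory.Balaban1983to89.B9CubeLettersCovarianceL0
import Literature.MathematicalPhysics.QuantumFieldTheory.Balaban1983to89.B9Thm311DeltaAGaugeOrbit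
import Literature.MathematicalPhysics.QuantumFieldTheory.Balaban1983to89.Node00.OpsYCubeKnitParCovariance

/-!
# `Balaban1983to89.B9CubeDirInverseBondCGaugeCovY` — [Balaban1985BackgroundPropagators] (3.28)–(3.34) pp. 395–396 ∕ Cor. 3.6 p. 408 FOR PRINT's DIRICHLET
# BOND LETTER OF THE CUBE SEQUENCE (letter (C) of record, `GDirCKY`): `G_□(U^u)R(u) = R(u)G_□(U)`, for its parts — the knit averaging pair `Q_□(U), Q*_□(U)`
# (corner-keyed), the local part `Δ_{loc,□}[Q_□](U)`, the projection letter `DP_□D*(U)` of record — and the regime transfer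
# `padΔ_{loc,□}(U^u)` a unit ↔ `padΔ_{loc,□}(U)` a unit

statement-level skeleton of published theorems with citation tags; proofs where landed; nothing here is a claim about the Yang–Mills mass gap

CITATION HEADER (lean-in-tree rule).  B9 = T. Bałaban, *Propagators for lattice gauge theories in a background field*, Commun. Math. Phys. **99** (1985)
389–434 [Balaban1985BackgroundPropagators]: (3.28) p. 395 («U^u_{⟨x,x′⟩} = u(x)U_{⟨x,x′⟩}u⁻¹(x′) … R(U^u(Γ_{y,x})) = R(u(y))R(U(Γ_{y,x}))R(u⁻¹(x))»),
(3.30)–(3.34) pp. 395–396 («Q_j(U^u)R(u) = R(u)Q_j(U)», «G′(U^u) = R(u)G′(U)R(u⁻¹), R(U^u) = R(u)R(U)R(u⁻¹) … Δ_a(U^u) = R(u)Δ_a(U)R(u⁻¹), G(U^u) =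
R(u)G(U)R(u⁻¹)»), Cor. 3.6 p. 408 («This follows from Corollary 3.5 applied to the configuration U′ = Uᵘ, and we have to recall only that all the results of
these theorems are gauge invariant, so they hold for the configuration U also»), p. 409 l. 1–5 («the operators G′_□(U), C_□(U), G_□(U) constructed for this
sequence»), (3.25)–(3.26) p. 394–395, (3.12)–(3.13) p. 393 (scalar products; `Q*` the adjoint of `Q`); T. Bałaban, *Averaging operations for lattice gauge
theories*, Commun. Math. Phys. **98** (1985) 17–51 [Balaban1985Averaging]: (11) p. 19 (the averaging transports to the CORNER of the block), (127) p. 37.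
Rows B9.Cor3.6 × B9.Eq3.28–3.34 (cells only; no row head changes).

WHY THIS FILE (cell `pub-ymgap`, node N06, seat `pub-ymgap-dag-n06-d` g35, INTENT-1, bus 2026-08-31).  The N06 heads of record («KE₁₉X-C» ∕ «KESC-CM») read the
bond estimate rows `h36Ab h36HA hopIA h36A2 hfacA` and the regime row `hUnitA` at print's operator of the cube sequence `G_□(U) = GDirCKY i □ (DP_□D*) B U =
𝟙_B (𝟙_B(Δ_{loc,□}[Q_□](U) − DP_□D*(U))𝟙_B + 1 − 𝟙_B)⁻¹ 𝟙_B` (✓`B9Eq3115KnitCubeLetterY`, ✓`B9DirichletBondCubePairY`).  Print proves the rows for a (3.35)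
configuration `U` by passing to the small axial gauge `U′ = Uᵘ` (Cor. 3.5) AND BACK by gauge covariance (Cor. 3.6: «all the results … are gauge invariant»).  The
covariance half for the SITE letter `G′_□` is def-Y's ✓`B9Eq360PadDeltaCubeY.GpDirY_cov_of_pairs` (used by dag-n06-c's site chain); for the member-local letters it
is dag-n06-j's ✓`B9DeltaALocalGaugeCovY`; for the straight cube pair at LAWFUL transporters it is r05's ✓`B9CubeLettersCovarianceL0`.  NONE covers the bond letter of
record: its averaging pair is the KNIT pair `(QknitCubeY, QsknitCubeY = adjTrY ∘ QknitCubeY)` (corner-keyed law, adjoint by the trace pairing), and its projection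
letter `DP_□D*` reads the cube knit table `parKnitCubeY i □`, which obeys the transporter law ONLY on corner pairs.  THIS FILE supplies exactly these laws and
assembles (3.34) for `G_□(U)`, together with the unit-locus transfer the `hUnitA` row needs along a gauge orbit.

WHAT IS PROVED (2 small `def`s — the corner gauge key of a pair `(j, c)` and its cube-index-bond reading; theorems; 0 sorry; 0 new named facts; standard axioms):
* §1 (generic) `intw_neg`; ★`intw_adjTrY_of_unitary` — an `R(u)`-intertwining `T′R(u_X) = R(u_Y)T` between `M_N(ℂ)`-valued lattice functions passes to def-Y's generic
  adjoints for UNITARY keys: `T′†R(u_Y) = R(u_X)T†` (`trIP_one_conjY_conjY` + uniqueness `adjTrY_eq_of_isAdjTr`); `isUnit_iff_of_intw_conjY`.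
* §2 (the knit cube pair) `gKnitPairY`, `uLev_liftFun_zSrcP` (`rfl`), `gKnitPairY_eq_gSrcCornerY` (dictionary with dag-n06-l's member key), `gKnitCubeY`; ★`knitRowY_gaugeY`
  (engine `linCovIterC_rot`); ★★`QknitCubeY_cov` ((3.32) for `Q_□(U)`, corner-keyed, `u ∈ U1`), `QknitCubeY_cov_unitary`, ★★`QsknitCubeY_cov` ((3.32)* by §1);
  `aCubeY_cov_of_key`; ★★`deltaLocCQY_cov` (generic pair with laws), ★`deltaLocCKY_cov` (the knit pair of record).
* §3 (the projection letter) generic `XCubeGY_cov_of`, `blkProjY_intw`, `XinvCubeDY_cov_of`, `PCubeDY_cov_of`, `RCubeDY_cov_of`, `CCubeDY_cov_of`, `DPDsCubeDY_cov_of`,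
  `P1CubeDY_cov_of`; at `parKnitCubeY`: `parKnitCubeY_gaugeY_of_blkOf`, ★`QpCubeY_parKnitCubeY_cov`, ★`QpsCubeY_parKnitCubeY_cov`, ★`XDirCubeY_cov`,
  `isUnitXDirCubeY_gaugeY_iff`, `RDirCubeY_cov`, `PDirCubeY_cov`, `CDirCubeY_cov`, ★★`DPDsDirCubeY_cov` ((3.33)′ for `DP_□D*` of record), `P1DirCubeY_cov`.
* §4 (the Dirichlet bond letter) `indProjY_intw`, generic `padDeltaLocCY_cov`, `GDirCY_cov`, ★`isUnit_padDeltaLocCY_gaugeY_iff`; at the record (`𝔸 = M_N(ℂ)`,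
  unitary-valued `u`): ★★★`GDirCKY_cov` (`G_□(U^u)R(u) = R(u)G_□(U)`), ★★`isUnit_padDeltaLocCKY_gaugeY_iff` (the heads' `hUnitA` object along gauge orbits),
  `padDeltaLocCKY_cov`.

PROOF.  Ours — def-Y's `Intw ∕ conjY ∕ gaugeY` calculus (`Node00.OpsYGauge`) run through the letters; the only analytic-looking input is the unitary
invariance of the trace pairing (dag-n06-j ✓`B9Thm311DeltaAGaugeOrbit.trIP_one_conjY_conjY`).  Ring identities; no estimate.

HONEST SCOPE / NOT CLAIMED.  Exact algebra: no inequality, no positivity, nothing of Theorems 3.1–3.15 ∕ Cor. 3.6's ESTIMATES is asserted; the small-field step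
(Cor. 3.5 at `Uᵘ`) and the member-block transfer for the bond rows are NOT here (dag-n06-c road (B5) ∕ its bond twin); the heads are UNCHANGED by this file.  The
knit laws ask `u ∈ U1` (resp. unitary-valued over `M_N(ℂ)`), as dag-n06-l's member law does.  Nothing on `d = 4`, the continuum, reflection positivity or the mass
gap; NOT a node discharge; count-neutral; no row head changes.

RELATED IN THE TREE, NOT DUPLICATED: ✓`B9CubeLettersCovarianceL0` (straight pair `QCubeY parB`, lawful `parS`; its `gBlkCubeY`, `aKc_eq_diagonal` USED BY NAME),
✓`B9DeltaALocalGaugeCovY` (`intw_dirPadY ∕ intw_dirInvY` USED BY NAME), ✓`B9Eq360PadDeltaCubeY` §4 (`GpDirY_cov_of_pairs` USED BY NAME),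
✓`B9Eq3115KnitLetterYLaws.QknitY_cov` (member letter; same engine), ✓`Node00.OpsYCubeKnitParCovariance` (corner laws of `parKnitCubeY`, USED BY NAME),
`B9Eq387CubeProjectionGaugeCovariance` (abstract `SiteL2K` carriers — a different formalisation layer).
-/

noncomputable section

open scoped BigOperators

namespace Literature.MathematicalPhysics.QuantumFieldTheory.Balaban1983to89.B9CubeDirInverseBondCGaugeCovY

open B7Prop1Explicit renaming Site → LSite
open B7Prop1Explicit (U1)
open B7Prop2Explicit (unitaryUnits)
open B7AvgGaugeCovariance (uLev uLev_apply)
open B7Prop4LinCovIterClosedLaws (linCovIterC_rot)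
open B10Eq27TorusAxialLog (transl)
open B6GlobalChartV1 (PV)
open B6KLevelCensusIndexV1 (KIdx)
open B6Cover236MultiLevelBlocks (cubes)
open B9B8CarrierDictionary (liftFun liftFun_apply liftCfg liftCfg_apply conjR_eq_R)
open B9B8KnitBondTransfer (liftBd)
open B9B8KnitLetterCovariance (liftCfg_gaugeY)
open B9Eq3115KnitLetterY (zSrc)
open B9Eq3115KnitLetterYLaws (liftBd_conjY_gBondY uLev_liftFun_zSrc)
open B9C2LettersTorusYCov (gSrcCornerY)
open B9Eq3115KnitCubeLetterY (zSrcP zSrc_eq_zSrcP knitRowY QknitCubeY QknitCubeY_apply QsknitCubeY QsknitCubeY_apply GDirCKY)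
open B9CubeLettersOpsL0 (cubeFamY levCubeY avgTrCubeY)
open B9CubeLettersBondOpsL0 (BlkCubeY IBondCubeY blkCornerCubeY qpKc qpsKc qpTc aCubeY QpCubeY QpsCubeY cWtCubeY)
open B9CubeLettersCovarianceL0 (gBlkCubeY aKc_eq_diagonal)
open B9Eq357CubeLetters (blkOf_of_qpKc_ne_zero blkOf_of_qpsKc_ne_zero)
open B9DirichletBondCubePairY (QCLetterY QCsLetterY deltaLocCQY padDeltaLocCY GDirCY)
open B9Thm311ReadingCoords (trIP IsAdjTr)
open B9DeltaALocalGaugeCovY (intw_dirPadY intw_dirInvY)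
open B9Eq360PadDeltaCubeY (GpDirY_cov_of_pairs)
open Node00
open Node00.OpsYQLetter (adjTrY adjTrY_eq_of_isAdjTr isAdjTr_adjTrY)
open Node00.OpsYLocalInverse (dirPadY dirInvY)
open Node00.OpsYCubeDirInverseBond (indProjY)
open Node00.OpsYCubeKnitPar (parKnitCubeY)
open Node00.OpsYCubeKnitParCovariance (parKnitCubeY_gaugeY_of_corner_left avgTrCubeY_parKnitCubeY_gaugeY)
open Node00.OpsYCubeProjectionG (blkProjY XCubeGY XinvCubeDY PCubeDY RCubeDY CCubeDY DPDsCubeDY P1CubeDY insideBlkY XDirCubeY IsUnitXDirCubeY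
  RDirCubeY PDirCubeY CDirCubeY DPDsDirCubeY P1DirCubeY)
open Node00.OpsYCubeDirInverse (GpDirY)
open B6Geom246MultiLevelBoxL0 (blkOf)
open B9Eq39Adjoint (R)
open scoped Matrix

variable {d ℓ : ℕ} {hd : 1 ≤ d + 1} {hL : Odd (ℓ + 1) ∧ 1 < ℓ + 1} {b₀ b₁ : ℝ}

/-! ## §1 Generic: negation, adjoints under unitary keys, unit loci along an intertwining -/

section GenericNeg

variable {M N : Type} [AddCommGroup M] [Module ℂ M] [AddCommGroup N] [Module ℂ N] {σ : M →ₗ[ℂ] M} {τ : N →ₗ[ℂ] N}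

/-- intertwinings pass to negatives. [cite: Balaban1985BackgroundPropagators, (3.28)–(3.30) p.395, bookkeeping] -/
theorem intw_neg {L L' : M →ₗ[ℂ] N} (h : Intw σ τ L L') : Intw σ τ (-L) (-L') := by
  unfold Intw at h ⊢
  rw [LinearMap.neg_comp, LinearMap.comp_neg, h]

end GenericNeg

section GenericAdj

open scoped Matrix.Norms.L2Operator

variable {N : ℕ} {X Y : Type} [Fintype X] [Fintype Y] [DecidableEq X]

/-- ★ **ADJOINTS UNDER UNITARY KEYS**: if `T′R(u_X) = R(u_Y)T` for unitary-valued keys `u_X, u_Y`, then def-Y's generic adjoints (for print's unit-weight scalar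
products) satisfy `T′†R(u_Y) = R(u_X)T†` — the adjoint action of a unitary is an isometry of the trace pairing, and the adjoint is unique.
[cite: Balaban1985BackgroundPropagators, (3.13) p.393 («Q* the adjoint of Q»), (3.30)–(3.32) pp.395–396 («Q_j(U^u)R(u) = R(u)Q_j(U)» and its adjoint)] -/
theorem intw_adjTrY_of_unitary {γX : X → (Matrix (Fin N) (Fin N) ℂ)ˣ} {γY : Y → (Matrix (Fin N) (Fin N) ℂ)ˣ}
    (hX : ∀ x, ((γX x : (Matrix (Fin N) (Fin N) ℂ)ˣ) : Matrix (Fin N) (Fin N) ℂ) ∈ unitary (Matrix (Fin N) (Fin N) ℂ))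
    (hY : ∀ y, ((γY y : (Matrix (Fin N) (Fin N) ℂ)ˣ) : Matrix (Fin N) (Fin N) ℂ) ∈ unitary (Matrix (Fin N) (Fin N) ℂ))
    {T T' : (X → Matrix (Fin N) (Fin N) ℂ) →ₗ[ℂ] (Y → Matrix (Fin N) (Fin N) ℂ)} (h : Intw (conjY γX) (conjY γY) T T') :
    Intw (conjY γY) (conjY γX) (adjTrY T) (adjTrY T') := by
  have h1 : ∀ Φ : X → Matrix (Fin N) (Fin N) ℂ, conjY γX (conjY γX⁻¹ Φ) = Φ := fun Φ => by
    rw [← LinearMap.comp_apply, ← conjY_mul, mul_inv_cancel, conjY_one, LinearMap.id_apply]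
  have h2 : ∀ Ψ : Y → Matrix (Fin N) (Fin N) ℂ, conjY γY (conjY γY⁻¹ Ψ) = Ψ := fun Ψ => by
    rw [← LinearMap.comp_apply, ← conjY_mul, mul_inv_cancel, conjY_one, LinearMap.id_apply]
  -- the conjugated adjoint is an adjoint partner of `T'`
  have hadj : IsAdjTr (fun _ => (1 : ℝ)) (fun _ => (1 : ℝ)) T' (conjY γX ∘ₗ adjTrY T ∘ₗ conjY γY⁻¹) := fun Φ Ψ => by
    have e1 : T' Φ = conjY γY (T (conjY γX⁻¹ Φ)) := by
      conv_lhs => rw [← h1 Φ]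
      exact h.apply _
    calc trIP (fun _ => (1 : ℝ)) (T' Φ) Ψ
        = trIP (fun _ => (1 : ℝ)) (conjY γY (T (conjY γX⁻¹ Φ))) (conjY γY (conjY γY⁻¹ Ψ)) := by rw [e1, h2]
      _ = trIP (fun _ => (1 : ℝ)) (T (conjY γX⁻¹ Φ)) (conjY γY⁻¹ Ψ) := B9Thm311DeltaAGaugeOrbit.trIP_one_conjY_conjY γY hY _ _
      _ = trIP (fun _ => (1 : ℝ)) (conjY γX⁻¹ Φ) (adjTrY T (conjY γY⁻¹ Ψ)) := isAdjTr_adjTrY T _ _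
      _ = trIP (fun _ => (1 : ℝ)) (conjY γX (conjY γX⁻¹ Φ)) (conjY γX (adjTrY T (conjY γY⁻¹ Ψ))) :=
          (B9Thm311DeltaAGaugeOrbit.trIP_one_conjY_conjY γX hX _ _).symm
      _ = trIP (fun _ => (1 : ℝ)) Φ ((conjY γX ∘ₗ adjTrY T ∘ₗ conjY γY⁻¹) Ψ) := by rw [h1]; rfl
  have e : adjTrY T' = conjY γX ∘ₗ adjTrY T ∘ₗ conjY γY⁻¹ := adjTrY_eq_of_isAdjTr hadj
  unfold Intw
  rw [e, LinearMap.comp_assoc, LinearMap.comp_assoc, ← conjY_mul, inv_mul_cancel, conjY_one, LinearMap.comp_id]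

end GenericAdj

section GenericUnit

variable {𝔸 : Type} [NormedRing 𝔸] [NormedAlgebra ℂ 𝔸] {X : Type}

/-- ★ **THE UNIT LOCUS IS CONSTANT ALONG AN `R(u)`-INTERTWINING**: if `T′R(u) = R(u)T` then `T′` is a unit iff `T` is (`T′ = R(u)TR(u)⁻¹`).
[cite: Balaban1985BackgroundPropagators, Cor. 3.6 p.408 («applied to the configuration U′ = Uᵘ»), (3.31) p.395] -/
theorem isUnit_iff_of_intw_conjY (γ : X → 𝔸ˣ) {T T' : Module.End ℂ (X → 𝔸)} (h : Intw (conjY γ) (conjY γ) T T') : IsUnit T' ↔ IsUnit T := by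
  obtain ⟨σu, hσu⟩ := isUnit_conjY (𝔸 := 𝔸) γ
  have e : T' = σu.1 * T * σu⁻¹.1 := by
    have h' : T' * σu.1 = σu.1 * T := by rw [hσu]; exact h
    rw [← h', mul_assoc, Units.mul_inv, mul_one]
  rw [e]
  constructor
  · intro hu
    have := (σu⁻¹).isUnit.mul (hu.mul σu.isUnit)
    simpa [mul_assoc] using this
  · intro hu
    exact (σu.isUnit.mul hu).mul (σu⁻¹).isUnit

end GenericUnit

/-! ## §2 The knit cube pair `(Q_□(U), Q*_□(U))` of record: corner key, (3.32), (3.32)*, and `Δ_{loc,□}[Q_□](U)` -/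

section Knit

variable {𝔸 : Type} [NormedRing 𝔸] [NormOneClass 𝔸] [NormedAlgebra ℂ 𝔸] [CompleteSpace 𝔸]
variable (i : KIdx d ℓ hd hL b₀ b₁) (q : ↥(cubes (toKT i).D.toDomains))

omit [NormOneClass 𝔸] in
/-- ★ **THE CORNER GAUGE KEY OF A PAIR `p = (j, c)`**: `u(0 + Lʲz_c)` — the gauge function at the CORNER site of the source block `Bʲ(c₋)` (the coarse gauge function
`u_j(z_c)` of [5] (11) read through the periodic lift). [cite: Balaban1985Averaging, (11) p.19, (7) p.19; Balaban1985BackgroundPropagators, (3.32) p.395] -/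
def gKnitPairY (g : GaugeY 𝔸 i) (p : (j : Fin (i.k + 1)) × PBond (PV d ℓ i.m i.K hd hL) (j : ℕ)) : 𝔸ˣ :=
  g (transl (0 : Site (PV d ℓ i.m i.K hd hL) 0) ((((ℓ + 1 : ℕ) : ℤ) ^ (p.1 : ℕ)) • zSrcP i p))

omit [NormOneClass 𝔸] in
/-- the B7 chain's levelled gauge function of the lift at the pair's label IS the corner key (`rfl`). [cite: Balaban1985Averaging, (11) p.19, dictionary] -/
theorem uLev_liftFun_zSrcP (g : GaugeY 𝔸 i) (p : (j : Fin (i.k + 1)) × PBond (PV d ℓ i.m i.K hd hL) (j : ℕ)) :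
    uLev (ℓ + 1) (liftFun (P := PV d ℓ i.m i.K hd hL) g) (p.1 : ℕ) (zSrcP i p) = gKnitPairY i g p := rfl

omit [NormOneClass 𝔸] in
/-- dictionary with dag-n06-l's member key: at a member index bond `ι`, the pair key of `ι.1` IS `gSrcCornerY i g ι`.
[cite: Balaban1985BackgroundPropagators, (3.32) p.395; Balaban1985Averaging, (11) p.19, dictionary] -/
theorem gKnitPairY_eq_gSrcCornerY (g : GaugeY 𝔸 i) (ι : IBondY i) : gKnitPairY i g ι.1 = gSrcCornerY i g ι := by
  rw [← uLev_liftFun_zSrcP, ← zSrc_eq_zSrcP]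
  exact uLev_liftFun_zSrc i g ι

omit [NormOneClass 𝔸] in
/-- ★ **THE CORNER KEY ON THE CUBE SEQUENCE's INDEX BONDS** `ι ↦ u(corner of the source block of ι.1)` — the transport target of `Q_□(U)`.
[cite: Balaban1985BackgroundPropagators, (3.12) p.393, (3.32) p.395, p.409 l.1–5; Balaban1985Averaging, (11) p.19] -/
def gKnitCubeY (g : GaugeY 𝔸 i) : IBondCubeY i q → 𝔸ˣ := fun ι => gKnitPairY i g ι.1

omit [NormOneClass 𝔸] in
/-- `gKnitCubeY`, evaluated. [cite: Balaban1985Averaging, (11) p.19, bookkeeping] -/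
theorem gKnitCubeY_apply (g : GaugeY 𝔸 i) (ι : IBondCubeY i q) : gKnitCubeY i q g ι = gKnitPairY i g ι.1 := rfl

/-- ★ **THE COMMON ROW KERNEL IS COVARIANT, CORNER-KEYED**: `knitRow[U^u](R(u)a)(p) = R(u(corner p))·knitRow[U](a)(p)` for `u ∈ U1` (the B7 chain's
`linCovIterC_rot` through the lift, as in dag-n06-l's `QknitY_gaugeY_apply`). [cite: Balaban1985BackgroundPropagators, (3.32) pp.395–396, (3.28) p.395; Balaban1985Averaging, (11) p.19, (127) p.37] -/
theorem knitRowY_gaugeY {g : GaugeY 𝔸 i} (hg : ∀ x, g x ∈ U1 𝔸) (U : CfgY 𝔸 i) (a : FBondY i → 𝔸)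
    (p : (j : Fin (i.k + 1)) × PBond (PV d ℓ i.m i.K hd hL) (j : ℕ)) :
    knitRowY i (gaugeY i g U) (conjY (gBondY i g) a) p = R (gKnitPairY i g p) (knitRowY i U a p) := by
  have hg' : ∀ x : LSite (d + 1), liftFun (P := PV d ℓ i.m i.K hd hL) g x ∈ U1 𝔸 := fun x => by
    rw [liftFun_apply]; exact hg _
  have hrot := linCovIterC_rot (ℓ + 1) (liftFun (P := PV d ℓ i.m i.K hd hL) g) hg' (liftCfg U) (liftBd i a) (p.1 : ℕ) (zSrcP i p) p.2.dir
  unfold knitRowY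
  rw [liftCfg_gaugeY, liftBd_conjY_gBondY, hrot, uLev_liftFun_zSrcP, conjR_eq_R, B9Eq39Adjoint.R_smul]

/-- ★★ **(3.32) FOR PRINT's `Q_□(U)` OF THE CUBE SEQUENCE, CORNER-KEYED**: `Q_□(U^u)R(u) = R(u∘corner)Q_□(U)` on the cube sequence's index bonds, `u ∈ U1`.
[cite: Balaban1985BackgroundPropagators, (3.32) pp.395–396, p.409 l.1–5; Balaban1985Averaging, (11) p.19] -/
theorem QknitCubeY_cov {g : GaugeY 𝔸 i} (hg : ∀ x, g x ∈ U1 𝔸) (U : CfgY 𝔸 i) :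
    Intw (conjY (gBondY i g)) (conjY (gKnitCubeY i q g)) (QknitCubeY i q U) (QknitCubeY i q (gaugeY i g U)) := by
  apply LinearMap.ext
  intro a
  funext ι
  rw [LinearMap.comp_apply, LinearMap.comp_apply, QknitCubeY_apply, conjY_apply, QknitCubeY_apply, gKnitCubeY_apply]
  exact knitRowY_gaugeY i hg U a ι.1

end Knit

section KnitMatrix

open scoped Matrix.Norms.L2Operator

variable {N : ℕ} [Nonempty (Fin N)] (i : KIdx d ℓ hd hL b₀ b₁) (q : ↥(cubes (toKT i).D.toDomains))

/-- (3.32) for `Q_□(U)` at UNITARY gauge functions over `M_N(ℂ)` (`U(N) ⊂ U1`). [cite: Balaban1985BackgroundPropagators, (3.32) pp.395–396, (3.35) p.396] -/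
theorem QknitCubeY_cov_unitary {g : GaugeY (Matrix (Fin N) (Fin N) ℂ) i} (hg : ∀ x, g x ∈ unitaryUnits (Matrix (Fin N) (Fin N) ℂ))
    (U : CfgY (Matrix (Fin N) (Fin N) ℂ) i) :
    Intw (conjY (gBondY i g)) (conjY (gKnitCubeY i q g)) (QknitCubeY i q U) (QknitCubeY i q (gaugeY i g U)) := by
  letI : CStarAlgebra (Matrix (Fin N) (Fin N) ℂ) := {}
  exact QknitCubeY_cov i q (fun x => B7Prop2Explicit.unitaryUnits_le_U1 (hg x)) U

/-- ★★ **(3.32)* FOR THE ADJOINT LETTER `Q*_□(U) = Q_□(U)†`**: `Q*_□(U^u)R(u∘corner) = R(u)Q*_□(U)` for unitary-valued `u` (§1's adjoint transfer of (3.32)).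
[cite: Balaban1985BackgroundPropagators, (3.13) p.393, (3.30)–(3.32) pp.395–396, p.409 l.1–5] -/
theorem QsknitCubeY_cov {g : GaugeY (Matrix (Fin N) (Fin N) ℂ) i} (hg : ∀ x, g x ∈ unitaryUnits (Matrix (Fin N) (Fin N) ℂ))
    (U : CfgY (Matrix (Fin N) (Fin N) ℂ) i) :
    Intw (conjY (gKnitCubeY i q g)) (conjY (gBondY i g)) (QsknitCubeY i q U) (QsknitCubeY i q (gaugeY i g U)) := by
  rw [QsknitCubeY_apply, QsknitCubeY_apply]
  exact intw_adjTrY_of_unitary (γX := gBondY i g) (γY := gKnitCubeY i q g) (fun b => hg b.src) (fun ι => hg _) (QknitCubeY_cov_unitary i q hg U)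

end KnitMatrix

section Pair

variable {𝔸 : Type} [NormedRing 𝔸] [NormedAlgebra ℂ 𝔸] [CompleteSpace 𝔸]
variable {i : KIdx d ℓ hd hL b₀ b₁} {q : ↥(cubes (toKT i).D.toDomains)} (g : GaugeY 𝔸 i) (U : CfgY 𝔸 i)
variable {𝔮c : QCLetterY 𝔸 i q} {𝔮cs : QCsLetterY 𝔸 i q}

omit [CompleteSpace 𝔸] in
/-- the cube sequence's weight `a_□` (a real diagonal multiplier) commutes with `R(u)` for ANY key on the index bonds.
[cite: Balaban1985BackgroundPropagators, (3.26) p.395, (3.34) p.396; Balaban1984PropagatorsII, (2.20) p.226] -/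
theorem aCubeY_cov_of_key (γC : IBondCubeY i q → 𝔸ˣ) : Intw (conjY γC) (conjY γC) (aCubeY (𝔸 := 𝔸) i q) (aCubeY i q) := by
  rw [aCubeY, aKc_eq_diagonal]
  exact intw_liftMatY_diagonal _ _

/-- ★★ **(3.34) FOR THE LOCAL PART `Δ_{loc,□}[𝔮_□](U) = Δ(U) + D_UD*_U + 𝔮⋆_□(U)a_□𝔮_□(U)` AT A GENERIC CUBE PAIR WITH LAWS**: if `𝔮_□(U^u)R(u) = R(γ)𝔮_□(U)` and
`𝔮⋆_□(U^u)R(γ) = R(u)𝔮⋆_□(U)` for some key `γ` on the index bonds, then `Δ_{loc,□}[𝔮_□](U^u)R(u) = R(u)Δ_{loc,□}[𝔮_□](U)`.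
[cite: Balaban1985BackgroundPropagators, (3.26) p.395, (3.30)–(3.34) pp.395–396, p.409 l.1–5] -/
theorem deltaLocCQY_cov {γC : IBondCubeY i q → 𝔸ˣ} (h𝔮c : Intw (conjY (gBondY i g)) (conjY γC) (𝔮c U) (𝔮c (gaugeY i g U)))
    (h𝔮cs : Intw (conjY γC) (conjY (gBondY i g)) (𝔮cs U) (𝔮cs (gaugeY i g U))) :
    Intw (conjY (gBondY i g)) (conjY (gBondY i g)) (deltaLocCQY i q 𝔮c 𝔮cs U) (deltaLocCQY i q 𝔮c 𝔮cs (gaugeY i g U)) := by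
  unfold deltaLocCQY
  exact ((hessY_cov i g U).add ((gradY_cov i g U).comp (divY_cov i g U))).add (h𝔮cs.comp ((aCubeY_cov_of_key γC).comp h𝔮c))

end Pair

section PairMatrix

open scoped Matrix.Norms.L2Operator

variable {N : ℕ} [Nonempty (Fin N)] (i : KIdx d ℓ hd hL b₀ b₁) (q : ↥(cubes (toKT i).D.toDomains))

/-- ★ **(3.34) FOR `Δ_{loc,□}[Q_□](U)` AT THE KNIT PAIR OF RECORD** (`𝔸 = M_N(ℂ)`, unitary-valued `u`).
[cite: Balaban1985BackgroundPropagators, (3.26) p.395, (3.34) p.396, p.409 l.1–5] -/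
theorem deltaLocCKY_cov {g : GaugeY (Matrix (Fin N) (Fin N) ℂ) i} (hg : ∀ x, g x ∈ unitaryUnits (Matrix (Fin N) (Fin N) ℂ))
    (U : CfgY (Matrix (Fin N) (Fin N) ℂ) i) :
    Intw (conjY (gBondY i g)) (conjY (gBondY i g)) (deltaLocCQY i q (QknitCubeY i q) (QsknitCubeY i q) U)
      (deltaLocCQY i q (QknitCubeY i q) (QsknitCubeY i q) (gaugeY i g U)) :=
  deltaLocCQY_cov g U (QknitCubeY_cov_unitary i q hg U) (QsknitCubeY_cov i q hg U)

end PairMatrix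

/-! ## §3 The projection letter `DP_□D*(U)`: generic laws at a site propagator `G′` and block cut `𝔖`, then the letters of record at `parKnitCubeY` -/

section Projection

variable {𝔸 : Type} [NormedRing 𝔸] [NormedAlgebra ℂ 𝔸] [CompleteSpace 𝔸]
variable {i : KIdx d ℓ hd hL b₀ b₁} {q : ↥(cubes (toKT i).D.toDomains)} (g : GaugeY 𝔸 i) (U : CfgY 𝔸 i)
variable {parS : SiteParY 𝔸 i} {Gp : SiteOpY 𝔸 i} {γS : BlkCubeY i q → 𝔸ˣ}

omit [CompleteSpace 𝔸] in
/-- the Dirichlet block cut `𝔖` (a real cut-off on block functions) commutes with `R(γ)` for any key. [cite: Balaban1985BackgroundPropagators, (3.28)–(3.30) p.395, p.394] -/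
theorem blkProjY_intw (γS : BlkCubeY i q → 𝔸ˣ) (𝔖 : Finset (BlkCubeY i q)) :
    Intw (conjY γS) (conjY γS) (blkProjY (𝔸 := 𝔸) i q 𝔖) (blkProjY i q 𝔖) := by
  unfold blkProjY
  exact B9Thm37CubeCoverCommutators.intw_cutMulY γS _

/-- (3.33)′ for `(Q′_□G′G′Q′*_□)(U)` at a generic site propagator: laws of `Q′_□`, `Q′*_□`, `G′` in ⇒ law out.
[cite: Balaban1985BackgroundPropagators, (3.25) p.394, (3.32)–(3.33) pp.395–396, p.409 l.1–5] -/
theorem XCubeGY_cov_of (hQp : Intw (conjY (gSiteY i g)) (conjY γS) (QpCubeY i q parS U) (QpCubeY i q parS (gaugeY i g U)))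
    (hQps : Intw (conjY γS) (conjY (gSiteY i g)) (QpsCubeY i q parS U) (QpsCubeY i q parS (gaugeY i g U)))
    (hGp : Intw (conjY (gSiteY i g)) (conjY (gSiteY i g)) (Gp U) (Gp (gaugeY i g U))) :
    Intw (conjY γS) (conjY γS) (XCubeGY i q parS Gp U) (XCubeGY i q parS Gp (gaugeY i g U)) := by
  unfold XCubeGY
  exact hQp.comp (hGp.comp (hGp.comp hQps))

/-- (3.33)′ for `(Q′_□G′G′Q′*_□)⁻¹(U)` inverted on the block functions over `𝔖`. [cite: Balaban1985BackgroundPropagators, (3.25) p.394, (3.33) p.396, p.409 l.1–5] -/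
theorem XinvCubeDY_cov_of (𝔖 : Finset (BlkCubeY i q))
    (hQp : Intw (conjY (gSiteY i g)) (conjY γS) (QpCubeY i q parS U) (QpCubeY i q parS (gaugeY i g U)))
    (hQps : Intw (conjY γS) (conjY (gSiteY i g)) (QpsCubeY i q parS U) (QpsCubeY i q parS (gaugeY i g U)))
    (hGp : Intw (conjY (gSiteY i g)) (conjY (gSiteY i g)) (Gp U) (Gp (gaugeY i g U))) :
    Intw (conjY γS) (conjY γS) (XinvCubeDY i q parS Gp 𝔖 U) (XinvCubeDY i q parS Gp 𝔖 (gaugeY i g U)) := by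
  unfold XinvCubeDY
  exact intw_dirInvY (isUnit_conjY _) (blkProjY_intw γS 𝔖) (XCubeGY_cov_of g U hQp hQps hGp)

/-- (3.33)′ for `P_□(U) = G′Q′*_□(Q′_□G′²Q′*_□)⁻¹Q′_□G′`. [cite: Balaban1985BackgroundPropagators, (3.25) p.394, (3.33) p.396 («R(U^u) = R(u)R(U)R(u⁻¹)»), p.409 l.1–5] -/
theorem PCubeDY_cov_of (𝔖 : Finset (BlkCubeY i q))
    (hQp : Intw (conjY (gSiteY i g)) (conjY γS) (QpCubeY i q parS U) (QpCubeY i q parS (gaugeY i g U)))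
    (hQps : Intw (conjY γS) (conjY (gSiteY i g)) (QpsCubeY i q parS U) (QpsCubeY i q parS (gaugeY i g U)))
    (hGp : Intw (conjY (gSiteY i g)) (conjY (gSiteY i g)) (Gp U) (Gp (gaugeY i g U))) :
    Intw (conjY (gSiteY i g)) (conjY (gSiteY i g)) (PCubeDY i q parS Gp 𝔖 U) (PCubeDY i q parS Gp 𝔖 (gaugeY i g U)) := by
  unfold PCubeDY
  exact hGp.comp (hQps.comp ((XinvCubeDY_cov_of g U 𝔖 hQp hQps hGp).comp (hQp.comp hGp)))

/-- ★ (3.33) for `R_□(U) = I − P_□(U)` at a generic site propagator. [cite: Balaban1985BackgroundPropagators, (3.25) p.394, (3.33) p.396 («R(U^u) = R(u)R(U)R(u⁻¹)»), p.409 l.1–5] -/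
theorem RCubeDY_cov_of (𝔖 : Finset (BlkCubeY i q))
    (hQp : Intw (conjY (gSiteY i g)) (conjY γS) (QpCubeY i q parS U) (QpCubeY i q parS (gaugeY i g U)))
    (hQps : Intw (conjY γS) (conjY (gSiteY i g)) (QpsCubeY i q parS U) (QpsCubeY i q parS (gaugeY i g U)))
    (hGp : Intw (conjY (gSiteY i g)) (conjY (gSiteY i g)) (Gp U) (Gp (gaugeY i g U))) :
    Intw (conjY (gSiteY i g)) (conjY (gSiteY i g)) (RCubeDY i q parS Gp 𝔖 U) (RCubeDY i q parS Gp 𝔖 (gaugeY i g U)) := by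
  unfold RCubeDY
  exact Intw.id.sub (hGp.comp (hQps.comp ((XinvCubeDY_cov_of g U 𝔖 hQp hQps hGp).comp (hQp.comp hGp))))

/-- (3.33)′ for `C_□(U)` read against the block pairing (a real diagonal weight on the right). [cite: Balaban1985BackgroundPropagators, (3.48) p.398, (3.33) p.396, p.409 l.1–5] -/
theorem CCubeDY_cov_of (𝔖 : Finset (BlkCubeY i q))
    (hQp : Intw (conjY (gSiteY i g)) (conjY γS) (QpCubeY i q parS U) (QpCubeY i q parS (gaugeY i g U)))
    (hQps : Intw (conjY γS) (conjY (gSiteY i g)) (QpsCubeY i q parS U) (QpsCubeY i q parS (gaugeY i g U)))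
    (hGp : Intw (conjY (gSiteY i g)) (conjY (gSiteY i g)) (Gp U) (Gp (gaugeY i g U))) :
    Intw (conjY γS) (conjY γS) (CCubeDY i q parS Gp 𝔖 U) (CCubeDY i q parS Gp 𝔖 (gaugeY i g U)) := by
  unfold CCubeDY
  exact (XinvCubeDY_cov_of g U 𝔖 hQp hQps hGp).comp (intw_liftMatY_diagonal _ _)

/-- ★★ (3.33)′∕(3.34)′ for the nonlocal part `D_UP_□(U)D*_U`. [cite: Balaban1985BackgroundPropagators, (3.26) p.395, (3.30)–(3.34) pp.395–396, (3.105) p.414, p.409 l.1–5] -/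
theorem DPDsCubeDY_cov_of (𝔖 : Finset (BlkCubeY i q))
    (hQp : Intw (conjY (gSiteY i g)) (conjY γS) (QpCubeY i q parS U) (QpCubeY i q parS (gaugeY i g U)))
    (hQps : Intw (conjY γS) (conjY (gSiteY i g)) (QpsCubeY i q parS U) (QpsCubeY i q parS (gaugeY i g U)))
    (hGp : Intw (conjY (gSiteY i g)) (conjY (gSiteY i g)) (Gp U) (Gp (gaugeY i g U))) :
    Intw (conjY (gBondY i g)) (conjY (gBondY i g)) (DPDsCubeDY i q parS Gp 𝔖 U) (DPDsCubeDY i q parS Gp 𝔖 (gaugeY i g U)) := by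
  unfold DPDsCubeDY
  exact (gradY_cov i g U).comp ((Intw.id.sub (RCubeDY_cov_of g U 𝔖 hQp hQps hGp)).comp (divY_cov i g U))

/-- (3.33)′ for `P_{□,1}(∂h)(U) = −[M_h, DP_□D*(U)]` (real cut-offs commute with `R(u)`). [cite: Balaban1985BackgroundPropagators, (3.101) p.414, (3.28)–(3.30) p.395] -/
theorem P1CubeDY_cov_of (h : SiteY i → ℝ) (𝔖 : Finset (BlkCubeY i q))
    (hQp : Intw (conjY (gSiteY i g)) (conjY γS) (QpCubeY i q parS U) (QpCubeY i q parS (gaugeY i g U)))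
    (hQps : Intw (conjY γS) (conjY (gSiteY i g)) (QpsCubeY i q parS U) (QpsCubeY i q parS (gaugeY i g U)))
    (hGp : Intw (conjY (gSiteY i g)) (conjY (gSiteY i g)) (Gp U) (Gp (gaugeY i g U))) :
    Intw (conjY (gBondY i g)) (conjY (gBondY i g)) (P1CubeDY i q h parS Gp 𝔖 U) (P1CubeDY i q h parS Gp 𝔖 (gaugeY i g U)) := by
  unfold P1CubeDY B9Eq3104CutoffCommutators.cutCommR
  have hA := DPDsCubeDY_cov_of g U 𝔖 hQp hQps hGp
  exact intw_neg (((B9Thm37CubeCoverCommutators.intw_cutMulY _ _).comp hA).sub (hA.comp (B9Thm37CubeCoverCommutators.intw_cutMulY _ _)))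

end Projection

section RecordProjection

variable {𝔸 : Type} [NormedRing 𝔸] [NormedAlgebra ℂ 𝔸] [CompleteSpace 𝔸]
variable (i : KIdx d ℓ hd hL b₀ b₁) (q : ↥(cubes (toKT i).D.toDomains)) (g : GaugeY 𝔸 i) (U : CfgY 𝔸 i)

/-- ★ **THE CUBE KNIT TABLE OBEYS THE TRANSPORTER LAW ON THE BLOCK-CORNER PAIRS `(c_s, z)`, `z ∈ Δ(s)`** (def-Y's `parKnitCubeY_gaugeY_of_corner_left` at the
cube sequence's blocks): `parKnitCubeY(U^u)(c_s, z) = u(c_s)·parKnitCubeY(U)(c_s, z)·u(z)⁻¹`. [cite: Balaban1985BackgroundPropagators, (3.19) p.393, (3.28) p.395, p.409 l.1–5] -/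
theorem parKnitCubeY_gaugeY_of_blkOf {s : BlkCubeY i q} {z : SiteY i} (h : blkOf (cubeFamY i q).toDomains z = s) :
    parKnitCubeY i q (gaugeY i g U) (blkCornerCubeY i q s) z =
      gSiteY i g (blkCornerCubeY i q s) * parKnitCubeY i q U (blkCornerCubeY i q s) z * (gSiteY i g z)⁻¹ := by
  have hc : cornerY i (levCubeY i q z) z = blkCornerCubeY i q s := by
    rw [B9Thm311CubeLettersFirstThree.cornerY_levCubeY_eq i q z, h]
  exact parKnitCubeY_gaugeY_of_corner_left i q g U hc

/-- the `Q′_□(U)` transporters at `parKnitCubeY` transform as contour variables ON THE SUPPORT OF THE KERNEL `q′_□`.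
[cite: Balaban1985BackgroundPropagators, (3.19) p.393, (3.32) p.395, p.409 l.1–5] -/
theorem qpTc_parKnitCubeY_gaugeY {s : BlkCubeY i q} {z : SiteY i} (h : qpKc i q s z ≠ 0) :
    qpTc i q (parKnitCubeY i q) (gaugeY i g U) s z = gBlkCubeY i q g s * qpTc i q (parKnitCubeY i q) U s z * (gSiteY i g z)⁻¹ :=
  parKnitCubeY_gaugeY_of_blkOf i q g U (blkOf_of_qpKc_ne_zero i q h)

/-- ★ **(3.32) FOR `Q′_□(U)` AT THE CUBE KNIT TABLE**: `Q′_□(U^u)R(u) = R(u∘corner)Q′_□(U)`. [cite: Balaban1985BackgroundPropagators, (3.19) p.393, (3.32) p.395, p.409 l.1–5] -/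
theorem QpCubeY_parKnitCubeY_cov :
    Intw (conjY (gSiteY i g)) (conjY (gBlkCubeY i q g)) (QpCubeY i q (parKnitCubeY i q) U) (QpCubeY i q (parKnitCubeY i q) (gaugeY i g U)) :=
  intw_trLiftY _ _ _ _ _ fun _ _ h => qpTc_parKnitCubeY_gaugeY i q g U h

/-- ★ **(3.32) FOR `Q′*_□(U)` AT THE CUBE KNIT TABLE**: `Q′*_□(U^u)R(u∘corner) = R(u)Q′*_□(U)`. [cite: Balaban1985BackgroundPropagators, (3.24)–(3.25) p.394, (3.32) p.395, p.409 l.1–5] -/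
theorem QpsCubeY_parKnitCubeY_cov :
    Intw (conjY (gBlkCubeY i q g)) (conjY (gSiteY i g)) (QpsCubeY i q (parKnitCubeY i q) U) (QpsCubeY i q (parKnitCubeY i q) (gaugeY i g U)) :=
  intw_trLiftY _ _ _ _ _ fun z s h => by
    have e := parKnitCubeY_gaugeY_of_blkOf i q g U (blkOf_of_qpsKc_ne_zero i q h)
    show (qpTc i q (parKnitCubeY i q) (gaugeY i g U) s z)⁻¹ = gSiteY i g z * (qpTc i q (parKnitCubeY i q) U s z)⁻¹ * (gBlkCubeY i q g s)⁻¹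
    rw [show qpTc i q (parKnitCubeY i q) (gaugeY i g U) s z = gBlkCubeY i q g s * qpTc i q (parKnitCubeY i q) U s z * (gSiteY i g z)⁻¹ from e,
      mul_inv_rev, mul_inv_rev, inv_inv, mul_assoc]

/-- ★ (3.33)′ for `(Q′_□G′_□²Q′*_□)(U)` OF RECORD (`G′_□ = GpDirY` at `parKnitCubeY`, Dirichlet data outside `S`).
[cite: Balaban1985BackgroundPropagators, (3.25) p.394, (3.33) p.396, Cor. 3.6 p.408, p.409 l.1–5] -/
theorem XDirCubeY_cov (S : Finset (SiteY i)) :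
    Intw (conjY (gBlkCubeY i q g)) (conjY (gBlkCubeY i q g)) (XDirCubeY i q S U) (XDirCubeY i q S (gaugeY i g U)) :=
  XCubeGY_cov_of g U (QpCubeY_parKnitCubeY_cov i q g U) (QpsCubeY_parKnitCubeY_cov i q g U)
    (GpDirY_cov_of_pairs q g U S fun _ _ h => avgTrCubeY_parKnitCubeY_gaugeY i q g U h)

/-- the regime hypothesis of record `IsUnitXDirCubeY` is constant on gauge orbits. [cite: Balaban1985BackgroundPropagators, (3.25) p.394, Cor. 3.6 p.408 («applied to the configuration U′ = Uᵘ»)] -/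
theorem isUnitXDirCubeY_gaugeY_iff (S : Finset (SiteY i)) : IsUnitXDirCubeY i q S (gaugeY i g U) ↔ IsUnitXDirCubeY i q S U := by
  unfold IsUnitXDirCubeY
  exact isUnit_iff_of_intw_conjY _ (intw_dirPadY (blkProjY_intw _ _) (XDirCubeY_cov i q g U S))

/-- ★ **(3.33) FOR `R_□(U)` OF RECORD**: `R_□(U^u)R(u) = R(u)R_□(U)`. [cite: Balaban1985BackgroundPropagators, (3.25) p.394, (3.33) p.396 («R(U^u) = R(u)R(U)R(u⁻¹)»), Cor. 3.6 p.408, p.409 l.1–5] -/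
theorem RDirCubeY_cov (S : Finset (SiteY i)) :
    Intw (conjY (gSiteY i g)) (conjY (gSiteY i g)) (RDirCubeY i q S U) (RDirCubeY i q S (gaugeY i g U)) :=
  RCubeDY_cov_of g U (insideBlkY i q S) (QpCubeY_parKnitCubeY_cov i q g U) (QpsCubeY_parKnitCubeY_cov i q g U)
    (GpDirY_cov_of_pairs q g U S fun _ _ h => avgTrCubeY_parKnitCubeY_gaugeY i q g U h)

/-- (3.33) for `P_□(U) = I − R_□(U)` of record. [cite: Balaban1985BackgroundPropagators, (3.25) p.394, (3.33) p.396, p.409 l.1–5] -/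
theorem PDirCubeY_cov (S : Finset (SiteY i)) :
    Intw (conjY (gSiteY i g)) (conjY (gSiteY i g)) (PDirCubeY i q S U) (PDirCubeY i q S (gaugeY i g U)) :=
  PCubeDY_cov_of g U (insideBlkY i q S) (QpCubeY_parKnitCubeY_cov i q g U) (QpsCubeY_parKnitCubeY_cov i q g U)
    (GpDirY_cov_of_pairs q g U S fun _ _ h => avgTrCubeY_parKnitCubeY_gaugeY i q g U h)

/-- (3.33)′ for `C_□(U)` of record. [cite: Balaban1985BackgroundPropagators, (3.48) p.398, (3.33) p.396, p.409 l.1–5] -/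
theorem CDirCubeY_cov (S : Finset (SiteY i)) :
    Intw (conjY (gBlkCubeY i q g)) (conjY (gBlkCubeY i q g)) (CDirCubeY i q S U) (CDirCubeY i q S (gaugeY i g U)) :=
  CCubeDY_cov_of g U (insideBlkY i q S) (QpCubeY_parKnitCubeY_cov i q g U) (QpsCubeY_parKnitCubeY_cov i q g U)
    (GpDirY_cov_of_pairs q g U S fun _ _ h => avgTrCubeY_parKnitCubeY_gaugeY i q g U h)

/-- ★★ **(3.33)′∕(3.34)′ FOR `DP_□D*(U)` OF RECORD** — the bond-side pin `Pl_□` of the letter (C): `(DP_□D*)(U^u)R(u) = R(u)(DP_□D*)(U)`.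
[cite: Balaban1985BackgroundPropagators, (3.26) p.395, (3.30)–(3.34) pp.395–396, (3.105) p.414, Cor. 3.6 p.408, p.409 l.1–5] -/
theorem DPDsDirCubeY_cov (S : Finset (SiteY i)) :
    Intw (conjY (gBondY i g)) (conjY (gBondY i g)) (DPDsDirCubeY i q S U) (DPDsDirCubeY i q S (gaugeY i g U)) :=
  DPDsCubeDY_cov_of g U (insideBlkY i q S) (QpCubeY_parKnitCubeY_cov i q g U) (QpsCubeY_parKnitCubeY_cov i q g U)
    (GpDirY_cov_of_pairs q g U S fun _ _ h => avgTrCubeY_parKnitCubeY_gaugeY i q g U h)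

/-- (3.33)′ for `P_{□,1}(∂h)(U)` of record. [cite: Balaban1985BackgroundPropagators, (3.101) p.414, (3.28)–(3.30) p.395] -/
theorem P1DirCubeY_cov (h : SiteY i → ℝ) (S : Finset (SiteY i)) :
    Intw (conjY (gBondY i g)) (conjY (gBondY i g)) (P1DirCubeY i q h S U) (P1DirCubeY i q h S (gaugeY i g U)) :=
  P1CubeDY_cov_of g U h (insideBlkY i q S) (QpCubeY_parKnitCubeY_cov i q g U) (QpsCubeY_parKnitCubeY_cov i q g U)
    (GpDirY_cov_of_pairs q g U S fun _ _ h => avgTrCubeY_parKnitCubeY_gaugeY i q g U h)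

end RecordProjection

/-! ## §4 The Dirichlet bond letter: padded compression, local inverse, unit-locus transfer; the letter of record `GDirCKY` -/

section Bond

variable {𝔸 : Type} [NormedRing 𝔸] [NormedAlgebra ℂ 𝔸] [CompleteSpace 𝔸]
variable {i : KIdx d ℓ hd hL b₀ b₁} {q : ↥(cubes (toKT i).D.toDomains)} (g : GaugeY 𝔸 i) (U : CfgY 𝔸 i)
variable {𝔮c : QCLetterY 𝔸 i q} {𝔮cs : QCsLetterY 𝔸 i q} {Pl : CfgY 𝔸 i → Module.End ℂ (FBondY i → 𝔸)} (B : Finset (FBondY i))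

omit [CompleteSpace 𝔸] in
/-- the bond projection `𝟙_B` (a real cut-off) commutes with `R(γ)` for any key. [cite: Balaban1985BackgroundPropagators, p.394, (3.28)–(3.30) p.395] -/
theorem indProjY_intw (γ : FBondY i → 𝔸ˣ) (B : Finset (FBondY i)) : Intw (conjY γ) (conjY γ) (indProjY (𝔸 := 𝔸) B) (indProjY B) := by
  unfold indProjY
  exact B9Thm37CubeCoverCommutators.intw_cutMulY γ _

/-- ★ **(3.34)′ FOR THE PADDED COMPRESSION `𝟙_B(Δ_{loc,□}[𝔮_□](U) − Pl_□(U))𝟙_B + 1 − 𝟙_B`** (generic pair ∕ generic `Pl_□` with laws).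
[cite: Balaban1985BackgroundPropagators, (3.34) p.396, p.394 («Ω₀Δ′_aΩ₀»), Cor. 3.6 p.408, p.409 l.1–5] -/
theorem padDeltaLocCY_cov
    (hΔ : Intw (conjY (gBondY i g)) (conjY (gBondY i g)) (deltaLocCQY i q 𝔮c 𝔮cs U) (deltaLocCQY i q 𝔮c 𝔮cs (gaugeY i g U)))
    (hPl : Intw (conjY (gBondY i g)) (conjY (gBondY i g)) (Pl U) (Pl (gaugeY i g U))) :
    Intw (conjY (gBondY i g)) (conjY (gBondY i g)) (padDeltaLocCY i q 𝔮c 𝔮cs Pl B U) (padDeltaLocCY i q 𝔮c 𝔮cs Pl B (gaugeY i g U)) := by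
  unfold padDeltaLocCY
  exact intw_dirPadY (indProjY_intw _ B) (hΔ.sub hPl)

/-- ★★ **(3.34) FOR THE DIRICHLET BOND LETTER AT A GENERIC PAIR**: `G_□(U^u)R(u) = R(u)G_□(U)` (`G_□ = 𝟙_B(padded compression)⁻¹𝟙_B`; `Ring.inverse` preserves
intertwinings). [cite: Balaban1985BackgroundPropagators, (3.34) p.396 («G(U^u) = R(u)G(U)R(u⁻¹)»), Cor. 3.6 p.408, p.409 l.1–5] -/
theorem GDirCY_cov
    (hΔ : Intw (conjY (gBondY i g)) (conjY (gBondY i g)) (deltaLocCQY i q 𝔮c 𝔮cs U) (deltaLocCQY i q 𝔮c 𝔮cs (gaugeY i g U)))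
    (hPl : Intw (conjY (gBondY i g)) (conjY (gBondY i g)) (Pl U) (Pl (gaugeY i g U))) :
    Intw (conjY (gBondY i g)) (conjY (gBondY i g)) (GDirCY i q 𝔮c 𝔮cs Pl B U) (GDirCY i q 𝔮c 𝔮cs Pl B (gaugeY i g U)) := by
  unfold GDirCY
  exact intw_dirInvY (isUnit_conjY _) (indProjY_intw _ B) (hΔ.sub hPl)

/-- ★ **THE REGIME OBJECT TRANSFERS ALONG GAUGE ORBITS**: `padΔ_{loc,□}(U^u)` is a unit iff `padΔ_{loc,□}(U)` is (generic pair ∕ `Pl_□` with laws).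
[cite: Balaban1985BackgroundPropagators, Cor. 3.6 p.408 («applied to the configuration U′ = Uᵘ … gauge invariant»), (3.31)–(3.34) pp.395–396] -/
theorem isUnit_padDeltaLocCY_gaugeY_iff
    (hΔ : Intw (conjY (gBondY i g)) (conjY (gBondY i g)) (deltaLocCQY i q 𝔮c 𝔮cs U) (deltaLocCQY i q 𝔮c 𝔮cs (gaugeY i g U)))
    (hPl : Intw (conjY (gBondY i g)) (conjY (gBondY i g)) (Pl U) (Pl (gaugeY i g U))) :
    IsUnit (padDeltaLocCY i q 𝔮c 𝔮cs Pl B (gaugeY i g U)) ↔ IsUnit (padDeltaLocCY i q 𝔮c 𝔮cs Pl B U) :=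
  isUnit_iff_of_intw_conjY _ (padDeltaLocCY_cov g U B hΔ hPl)

end Bond

section Record

open scoped Matrix.Norms.L2Operator

variable {N : ℕ} [Nonempty (Fin N)] (i : KIdx d ℓ hd hL b₀ b₁) (q : ↥(cubes (toKT i).D.toDomains))
  {g : GaugeY (Matrix (Fin N) (Fin N) ℂ) i} (U : CfgY (Matrix (Fin N) (Fin N) ℂ) i)

/-- ★★ (3.34)′ for the regime object OF RECORD `padΔ_{loc,□}[Q_□](U)` (knit pair, `Pl_□ = DP_□D*` of record, Dirichlet data outside `S`, bond set `B`), unitary-valued `u`.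
[cite: Balaban1985BackgroundPropagators, (3.34) p.396, Cor. 3.6 p.408, p.409 l.1–5] -/
theorem padDeltaLocCKY_cov (hg : ∀ x, g x ∈ unitaryUnits (Matrix (Fin N) (Fin N) ℂ)) (S : Finset (SiteY i)) (B : Finset (FBondY i)) :
    Intw (conjY (gBondY i g)) (conjY (gBondY i g))
      (padDeltaLocCY i q (QknitCubeY i q) (QsknitCubeY i q) (DPDsDirCubeY i q S) B U)
      (padDeltaLocCY i q (QknitCubeY i q) (QsknitCubeY i q) (DPDsDirCubeY i q S) B (gaugeY i g U)) :=
  padDeltaLocCY_cov g U B (deltaLocCKY_cov i q hg U) (DPDsDirCubeY_cov i q g U S)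

/-- ★★★ **(3.34) FOR PRINT's DIRICHLET BOND LETTER OF THE CUBE SEQUENCE — THE LETTER (C) OF RECORD**: `G_□(U^u)R(u) = R(u)G_□(U)` for
`G_□ = GDirCKY i □ (DP_□D*) B` at the knit pair, every background `U`, every unitary-valued gauge function `u` — Cor. 3.6's «all the results of these theorems are
gauge invariant» for the bond letter the N06 heads of record read. [cite: Balaban1985BackgroundPropagators, (3.34) p.396 («G(U^u) = R(u)G(U)R(u⁻¹)»), Cor. 3.6 p.408, p.409 l.1–5] -/
theorem GDirCKY_cov (hg : ∀ x, g x ∈ unitaryUnits (Matrix (Fin N) (Fin N) ℂ)) (S : Finset (SiteY i)) (B : Finset (FBondY i)) :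
    Intw (conjY (gBondY i g)) (conjY (gBondY i g)) (GDirCKY i q (DPDsDirCubeY i q S) B U) (GDirCKY i q (DPDsDirCubeY i q S) B (gaugeY i g U)) :=
  GDirCY_cov g U B (deltaLocCKY_cov i q hg U) (DPDsDirCubeY_cov i q g U S)

/-- ★★ **THE HEADS' REGIME ROW `hUnitA` ALONG A GAUGE ORBIT**: `padΔ_{loc,□}[Q_□](U^u)` (knit pair, `DP_□D*` of record) is a unit iff `padΔ_{loc,□}[Q_□](U)` is —
the transfer Cor. 3.6 uses between `U` and its small axial gauge `Uᵘ`. [cite: Balaban1985BackgroundPropagators, Cor. 3.6 p.408 («applied to the configuration U′ = Uᵘ»), (3.34) p.396, p.409 l.1–5] -/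
theorem isUnit_padDeltaLocCKY_gaugeY_iff (hg : ∀ x, g x ∈ unitaryUnits (Matrix (Fin N) (Fin N) ℂ)) (S : Finset (SiteY i)) (B : Finset (FBondY i)) :
    IsUnit (padDeltaLocCY i q (QknitCubeY i q) (QsknitCubeY i q) (DPDsDirCubeY i q S) B (gaugeY i g U)) ↔
      IsUnit (padDeltaLocCY i q (QknitCubeY i q) (QsknitCubeY i q) (DPDsDirCubeY i q S) B U) :=
  isUnit_padDeltaLocCY_gaugeY_iff g U B (deltaLocCKY_cov i q hg U) (DPDsDirCubeY_cov i q g U S)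

end Record

end Literature.MathematicalPhysics.QuantumFieldTheory.Balaban1983to89.B9CubeDirInverseBondCGaugeCovY

end
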